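import Mathlib
import HarnessLib
import Summits.HubbardSuperconductivity.HubbardSuperconductivity.Theorems.KLProgrammeKLRegimeEngineTowerBlockIncrWt
import Summits.HubbardSuperconductivity.HubbardSuperconductivity.Theorems.KLProgrammeKLRegimeEngineTowerBlockStepWtSubTadpole
import Summits.HubbardSuperconductivity.HubbardSuperconductivity.Theorems.KLProgrammeKLRegimeEngineTowerModelDefsPow

/-!
# Route `KLProgramme` — crux K3 ENGINE (stmt-HubbardSuperconductivity-20437 `KLRegimeEngineV17F2`), stub (b) / E1 interface (E2) in-tower route and located risk #17
# «(C2)-MOMENTS», located item «(E2)-ROUTE-TADPOLE»: THE DEGREE-`Dw` WEIGHTED BORN SIZES OF A BLOCK INCREMENT WITHOUT ITS BLOCK TADPOLE, in the rate-decoupled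
# carrier `klWtPinnedSumPow` (one pinned leg, the other sectors summed) — `Δ_k − Δ_Γ 𝒱_{dk}`, pieces 2–3 of the three-piece split
# (recipe «(E2)-POW3-TRACK» option (i), `klWtPinnedSumPow`-currency layer N3; cell gate-hubbard-kl, seat hubbard-kl-k3c3-p2 g19)

`…TowerBlockIncrWtPowAt` (`klWtPinnedSumPow_klTowerIncr_le`) bounds the FULL increment, whose two-leg part contains the block tadpole `Δ_Γ 𝒱_{dk}` (first order in the quartic
input, bare-`U` part exactly local).  Here the same doors with the binomial one replaced by `blockStep_geTwoLines_wt_le` (…TowerBlockStepWtSubTadpole): the left side is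
`klWtPinnedSumPow … J′ jr Dw (2(q+1)) (Δ_k − Δ_Γ 𝒱_{dk}) i w″`, the binomial right side sums over the input degrees `m′ > q + 2` (two legs: `2m′ ≥ 6` — NO quartic tadpole).
This is the object whose spatially OFF-DIAGONAL / pure moments the #17-Z atom `TwoLegSpaceMomentAt` and the (E2) reader's symbol data want (its `U`-linear local mass is gone):
feed `shellRow_spaceMomentPow_le_of_klWtPinnedSumPow` with `T := Δ_k − Δ_Γ 𝒱_{dk}`.  DEF-FREE.

* **`klWtPinnedSumPow_klTowerIncr_subTadpole_le (jr Dw)`** — binders of `klWtPinnedSumPow_klTowerIncr_le` verbatim.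
Composition of landed theorems; the block constants are HYPOTHESES; nothing asserts (E2), (X).3, any stub, K3 or superconductivity.
References: BGM 2006 §2.7 (2.70)–(2.71a), §2.8 (2.76)–(2.84), (2.86)–(2.90), §3 (3.5)–(3.6) [cite: BenfattoGiulianiMastropietro2006].
-/

noncomputable section

namespace Summit.HubbardSuperconductivity.HubbardSuperconductivity.Theorems.EngineV8

set_option linter.dupNamespace false -- summit = problem name (single-conjunct summit), D-0017

open Real Finset Literature.MathematicalPhysics.QuantumLattice Literature.Probability.LatticeModels GrassmannAlgebra
open Summit.HubbardSuperconductivity.HubbardSuperconductivity.Theorems.KLProgrammeLegKernels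
open Summit.HubbardSuperconductivity.HubbardSuperconductivity.Theorems.KLRegimeSplit
open Summit.HubbardSuperconductivity.HubbardSuperconductivity.Theorems.KLRegimeWick
open Summit.HubbardSuperconductivity.HubbardSuperconductivity.Theorems.TwoPointAssembly
open Literature.Probability.LatticeModels.BattleFederbush

section Born

variable {L M : ℕ} [NeZero L] [NeZero M]

/-- **THE DEGREE-`Dw` RATE-`jr` WEIGHTED ONE-PINNED-LEG SIZES OF A BLOCK INCREMENT WITHOUT ITS BLOCK TADPOLE** (`klWtPinnedSumPow` currency).
[cite: BenfattoGiulianiMastropietro2006, (2.70)-(2.71a), (2.86)-(2.90), (3.5)-(3.6)] -/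
theorem klWtPinnedSumPow_klTowerIncr_subTadpole_le {β : ℝ} (hβ : 0 < β) (U μ : ℝ) (K : TrigPolyC4v) (jr Dw : ℕ) {d k J' : ℕ} (hd : 1 ≤ d) (hk : 1 ≤ k) (hJ' : d * k ≤ J')
    (hZ : hubbardEffPartitionFnCT L M β U μ 0 K (klScale klE0 (d * k)) ≠ 0)
    {κ : ℝ} (hκ : 0 < κ)
    (hGB : IsGramBoundedR ((sectorSubMatrix L M β (bgmFatMultiplier L M klE0 β (nambuXiCT L μ K) (d * k - 1))).transpose *
      hubbardCovSliceCT L M β μ 0 K (klScale klE0 (d * (k + 1))) (klScale klE0 (d * k)) *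
        sectorSubMatrix L M β (bgmFatMultiplier L M klE0 β (nambuXiCT L μ K) (d * k - 1))) κ)
    (B : ℕ → ℝ) (hB0 : ∀ m', 0 ≤ B m')
    (hB : ∀ (m' : ℕ) (j : Fin (2 * m')) (w : SpaceTimeIdx L M × SectorLeg (sectorCount (d * k - 1))),
      ∑ Y ∈ univ.filter (fun Y : Fin (2 * m') → SpaceTimeIdx L M × SectorLeg (sectorCount (d * k - 1)) => Y j = w),
        klScaleWtPow L M β jr Dw ((univ.image Y).image (latticeLegPos (2 * (2 * M)))) *
          ‖kernel ℂ (ExteriorAlgebra.map (Matrix.toLin' (sectorAnalysisMatrix L M β (klAnisoFamily L M β μ K klE0 (d * k - 1))))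
            (klTowerInput L M β U μ K d k)) (2 * m') Y‖ ≤ B m')
    {α : ℝ} (hα : 0 < α)
    (hrow : ∀ X, ∑ Y, ‖((sectorSubMatrix L M β (bgmFatMultiplier L M klE0 β (nambuXiCT L μ K) (d * k - 1))).transpose *
        hubbardCovSliceCT L M β μ 0 K (klScale klE0 (d * (k + 1))) (klScale klE0 (d * k)) *
          sectorSubMatrix L M β (bgmFatMultiplier L M klE0 β (nambuXiCT L μ K) (d * k - 1))) X Y‖ *
        klScaleWtPow L M β jr Dw {latticeLegPos (2 * (2 * M)) X, latticeLegPos (2 * (2 * M)) Y} ≤ α)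
    (hcol : ∀ Y, ∑ X, ‖((sectorSubMatrix L M β (bgmFatMultiplier L M klE0 β (nambuXiCT L μ K) (d * k - 1))).transpose *
        hubbardCovSliceCT L M β μ 0 K (klScale klE0 (d * (k + 1))) (klScale klE0 (d * k)) *
          sectorSubMatrix L M β (bgmFatMultiplier L M klE0 β (nambuXiCT L μ K) (d * k - 1))) X Y‖ *
        klScaleWtPow L M β jr Dw {latticeLegPos (2 * (2 * M)) X, latticeLegPos (2 * (2 * M)) Y} ≤ α)
    {ρ : ℝ} (hρ : 0 < ρ)
    (hθ : Real.exp 1 * α * normV (SpaceTimeIdx L M × SectorLeg (sectorCount (d * k - 1))) κ ρ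
      (fun m' => imagTimeWeight β M ^ (2 * m') * B m') / κ ^ 2 < 1)
    {cr cc : ℝ} (hcc0 : 0 ≤ cc)
    (hrow' : ∀ X'', ∑ X', ‖(sectorAnalysisMatrix L M β (klAnisoFamily L M β μ K klE0 J') *
        sectorSubMatrix L M β (bgmFatMultiplier L M klE0 β (nambuXiCT L μ K) (d * k - 1))) X'' X'‖ *
        klScaleWtPow L M β jr Dw {latticeLegPos (2 * (2 * M)) X'', latticeLegPos (2 * (2 * M)) X'} ≤ cr)
    (hcol' : ∀ X', ∑ X'', ‖(sectorAnalysisMatrix L M β (klAnisoFamily L M β μ K klE0 J') *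
        sectorSubMatrix L M β (bgmFatMultiplier L M klE0 β (nambuXiCT L μ K) (d * k - 1))) X'' X'‖ *
        klScaleWtPow L M β jr Dw {latticeLegPos (2 * (2 * M)) X'', latticeLegPos (2 * (2 * M)) X'} ≤ cc)
    {N₀ : ℕ} (hN₀ : 2 ≤ N₀) (q : ℕ) (i : Fin (2 * (q + 1))) (w'' : SpaceTimeIdx L M × SectorLeg (sectorCount J')) :
    klWtPinnedSumPow L M β μ K J' jr Dw (2 * (q + 1))
        (klTowerIncr L M β U μ K d k - grassmannLaplacian ℂ (hubbardCovSliceCT L M β μ 0 K (klScale klE0 (d * (k + 1))) (klScale klE0 (d * k))) (klTowerInput L M β U μ K d k)) i w'' ≤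
      imagTimeWeight β M ^ (2 * q + 1) *
        (cr * cc ^ (2 * q + 1) *
          (∑ n ∈ Ico 2 N₀, (ρ⁻¹ ^ (2 * q + 1 + 1) * κ⁻¹ ^ (2 * (n - 1)) * (α ^ (n - 1) * Real.exp n)) *
              ∑ δ ∈ (Fintype.piFinset fun _ : Fin n => range (Fintype.card (SpaceTimeIdx L M × SectorLeg (sectorCount (d * k - 1))) / 2 + 1)) with
                  2 * q + 1 + 1 + 2 * (n - 1) ≤ ∑ a, 2 * δ a,
                ∏ a, (Real.exp 2 * (κ + ρ)) ^ (2 * δ a) * (imagTimeWeight β M ^ (2 * δ a) * B (δ a)) +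
            ρ⁻¹ ^ (2 * q + 1 + 1) *
              (Real.exp 1 * normV (SpaceTimeIdx L M × SectorLeg (sectorCount (d * k - 1))) κ ρ (fun m' => imagTimeWeight β M ^ (2 * m') * B m')) *
              (Real.exp 1 * α * normV (SpaceTimeIdx L M × SectorLeg (sectorCount (d * k - 1))) κ ρ
                  (fun m' => imagTimeWeight β M ^ (2 * m') * B m') / κ ^ 2) ^ (N₀ - 1) /
              (1 - Real.exp 1 * α * normV (SpaceTimeIdx L M × SectorLeg (sectorCount (d * k - 1))) κ ρ
                  (fun m' => imagTimeWeight β M ^ (2 * m') * B m') / κ ^ 2)) +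
        cr * cc ^ (2 * q + 1) *
          ∑ m' ∈ range (Fintype.card (SpaceTimeIdx L M × SectorLeg (sectorCount (d * k - 1))) / 2 + 1),
            (if q + 1 + 1 < m' then ((2 * m').choose (2 * (q + 1)) : ℝ) * κ ^ (2 * m' - 2 * (q + 1)) *
              (imagTimeWeight β M ^ (2 * m') * B m') else 0)) := by
  have hβ' : β ≠ 0 := hβ.ne'
  have hJ₁ : 1 ≤ d * k := le_trans hd (Nat.le_mul_of_pos_right d hk)
  have hJ : d * k ≤ d * (k + 1) := Nat.mul_le_mul_left d (Nat.le_succ k)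
  have hwt := isTreeWeight_klScaleWtPow L M hβ.le jr Dw
  have hG : klTowerInput L M β U μ K d k ∈ evenPart ℂ (HubbardFieldIdx L M) := klEffectiveAction_mem_evenPart hβ' U μ K klE0 (d * k)
  have hG0 : constPart ℂ (klTowerInput L M β U μ K d k) = 0 := constPart_klEffectiveAction_eq_zero β U μ K klE0 (d * k) hZ
  have hε : 0 ≤ imagTimeWeight β M := imagTimeWeight_nonneg hβ.le M
  -- split the increment and the pinned sum
  have h2 := blockStep_ordersGe2_wt_le (L := L) (M := M) hwt hβ μ K hJ₁ hJ hJ' (latticeLegPos (2 * (2 * M))) (latticeLegPos (2 * (2 * M)))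
    (klTowerInput L M β U μ K d k) hG hG0 hκ hGB B hB0 hB hα hrow hcol hρ hθ hcc0 hrow' hcol' hN₀ (2 * q + 1) i w''
  have h1 := blockStep_geTwoLines_wt_le (L := L) (M := M) hwt hβ μ K hJ₁ hJ hJ' (latticeLegPos (2 * (2 * M))) (latticeLegPos (2 * (2 * M)))
    (klTowerInput L M β U μ K d k) hG hκ.le hGB B hB0 hB hcc0 hrow' hcol' q i w''
  rw [show klTowerIncr L M β U μ K d k - grassmannLaplacian ℂ (hubbardCovSliceCT L M β μ 0 K (klScale klE0 (d * (k + 1))) (klScale klE0 (d * k))) (klTowerInput L M β U μ K d k) =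
      (effAction ℂ (hubbardCovSliceCT L M β μ 0 K (klScale klE0 (d * (k + 1))) (klScale klE0 (d * k))) (klTowerInput L M β U μ K d k) -
          gaussConv ℂ (hubbardCovSliceCT L M β μ 0 K (klScale klE0 (d * (k + 1))) (klScale klE0 (d * k))) (klTowerInput L M β U μ K d k)) +
        (gaussConv ℂ (hubbardCovSliceCT L M β μ 0 K (klScale klE0 (d * (k + 1))) (klScale klE0 (d * k))) (klTowerInput L M β U μ K d k) -
          klTowerInput L M β U μ K d k -
          grassmannLaplacian ℂ (hubbardCovSliceCT L M β μ 0 K (klScale klE0 (d * (k + 1))) (klScale klE0 (d * k))) (klTowerInput L M β U μ K d k)) from by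
    rw [klTowerIncr_eq_ordersGe2_add_firstOrder β U μ K d k hZ]; abel]
  refine (klWtPinnedSumPow_add_le hβ.le μ K J' jr Dw _ _ _ i w'').trans ?_
  rw [mul_add (imagTimeWeight β M ^ (2 * q + 1))]
  exact add_le_add
    ((klWtPinnedSumPow_succ β μ K J' jr Dw (2 * q + 1) _ i w'').le.trans (mul_le_mul_of_nonneg_left h2 (pow_nonneg hε _)))
    ((klWtPinnedSumPow_succ β μ K J' jr Dw (2 * q + 1) _ i w'').le.trans (mul_le_mul_of_nonneg_left h1 (pow_nonneg hε _)))

end Born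

end Summit.HubbardSuperconductivity.HubbardSuperconductivity.Theorems.EngineV8

end
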